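import Summits.AtomisticToContinuum.HydrodynamicLimit.Theses.OneFlightGossipEngine
import Summits.AtomisticToContinuum.HydrodynamicLimit.Theorems.BandCoherenceLDAlongFamilies.Negative.BoostFloor
import Summits.AtomisticToContinuum.HydrodynamicLimit.Theorems.KineticCurrentsWindowLDUniform.Negative.LoadBearing
import HarnessLib

/-!
# Refutation of `OneFlightGossipEngine.BandCoherenceLDAlongFamilies` (stmt-AtomisticToContinuum-17700)

`theorem OneFlightGossipEngineBandCoherenceLDAlongFamilies_refuted : ¬ BandCoherenceLDAlongFamilies` — the GALILEAN-BOOST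
(drift) witness, class **refuted-misstated** (fixed tilt `(8Θ̄K₁)⁻¹` with `∀ η > 0` and no zero-drift / signed-current
normalisation; see the docstring of the theorem for the repaired statement).

## The witness (refuter-cdisprove-stmt-AtomisticToContinuum-17700-0; the same mechanism was found independently by
refuter-rattack-17700-0 (WITNESS.md, helper files `Negative/Pathwise.lean`, `Negative/Gauss.lean`, reused here) and the
crux ideators k1/k2)

Constant family `t₁ = 0`, `a ≡ 1`, `θ ≡ Θ̄ = 1`, `u ≡ 0`; reduced diameter `σ = min(1/4, η₀, 1)` (packing guard); the
Alexander flows; radial weight `R(s′) = (s′ − k²)·1{k² < s′ ≤ K²}`; `K = M + 3` with `M = E(1 + ‖ξ‖)⁶` (standard Gaussian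
on `ℝ³`), `k = 1/K`, `η = 1/(4K(1+M))`, `ε = 1/(40K²)`. For EVERY window `w > 0`, EVERY `N` and EVERY hard-sphere flow,
the tested functional `S = Σᵢ 1{η·cubᵢ < ‖q̄ᵢ‖}·cubBandᵢ` satisfies (`BandCoherenceLDBoostFloor.boost_floor`,
helper file `Theorems/BandCoherenceLDAlongFamilies/Negative/BoostFloor.lean`)

  `(N+1)⁻¹ log ∫ e^{λS} dG₀ ≥ λ(5D − k²D − k³ − M/K³ − η(1+M)) − D²/2`,   `λ = (8K)⁻¹`, any `0 ≤ D ≤ 1`,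

by Donsker–Varadhan against the BOOSTED homogeneous Gibbs law `G_D` (drift `D e₀`): (i) pathwise
`S ≥ Σᵢ (q̄ᵢ,₀ − η cubᵢ)` (`BandCoherenceLDNegative.linear_le_summand`); (ii) `G_D` is invariant under every hard-sphere
flow (Liouville + conservation of `Σ|vᵢ − De₀|²`), so window time averages of one-body sums have STATIC expectations
(`BoltzmannGreenKuboOrthMomentum.integral_window_eq`), and the one-body velocity marginal of `G_D` is `N(De₀, 1)`;
(iii) the linear response `E_{N(De₀,1)} R(‖v‖²)v₀ ≥ 5D − k²D − k³ − E‖v‖⁶/K³` (`BandCoherenceLDNegative.gamma_lower`)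
against the quadratic cost `KL(G_D ‖ G₀) = (N+1)D²/2`. At `D = 1/K` the floor is `≥ 5/(96K²) > ε`, while the crux
offers `τ₀, N₀` with `∫ e^{λS} dG₀ ≤ e^{ε(N₀+1)}` at `τ = τ₀`, `N = N₀`, `s = 0` — contradiction. No dynamics beyond
invariance is used: the drift `D e₀` is a conserved coherent band current that the fixed tilt pays linearly.

References: S. Olla, S. R. S. Varadhan, H.-T. Yau, Comm. Math. Phys. 155 (1993) §2 (entropy inequality);
H. Spohn, *Large Scale Dynamics of Interacting Particles* (1991), Part I §2.3 (local Gibbs states, Galilean frames).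
-/

noncomputable section

open MeasureTheory ProbabilityTheory Set Filter Topology
open scoped ENNReal InnerProductSpace BigOperators

namespace Summit.AtomisticToContinuum.HydrodynamicLimit.Theorems

open Literature.MathematicalPhysics.KineticTheory Literature.Analysis.FluidPDE
open BandCoherenceLDNegative KineticFluxLdDecayTilt BandCoherenceLDBoostFloor
open KineticCurrentsWindowLDUniformLoadBearing (sigmaOf sigmaOf_spec guard_sigmaOf)

/-- Refutes `OneFlightGossipEngine.BandCoherenceLDAlongFamilies` (stmt-AtomisticToContinuum-17700) **[refuted-misstated]**.
Informal: the reference-law band-coherence exponential moment at the FIXED tilt `(8Θ̄K₁)⁻¹` is NOT `e^{o(N)}` — a uniform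
Galilean drift `D e₀` of the homogeneous reference law costs `(N+1)D²/2` in relative entropy (quadratic) but, being
conserved by every hard-sphere flow, makes the coherently carried band content respond LINEARLY (`≈ 5D` per particle for
the admissible weight `R(s′) = (s′ − k²)1{k² < s′ ≤ K²}`), for every window `τ` and every `N`.
Witness: `η₀` arbitrary; `t₁ = 0`, `Θ̄ = 1`, `a ≡ θ ≡ 1`, `u ≡ 0`, `σ = min(1/4, η₀, 1)`, the regularised Alexander flows,
`K₁ = K = M + 3` (`M = E(1+‖ξ‖)⁶`, `ξ ~ N(0, I₃)`), `K⋆ = k = 1/K`, `R` as above, `η = 1/(4K(1+M))`, `ε = 1/(40K²)`; at the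
offered `τ₀, N₀` and `s = 0` the functional is `≥ exp((N₀+1)·5/(96K²)) > exp(ε(N₀+1))` (`BandCoherenceLDBoostFloor.boost_floor`
with `D = 1/K`).
Repair (misstated: the fixed tilt with `∀ η` ignores the zero-cost Galilean/thermal soft modes of the reference law): the
minimal statement this witness misses replaces the fixed tilt by a tilt chosen AFTER `ε` —
`C′ := … ∀ η > 0 ∀ ε > 0 ∃ β₀ > 0 ∀ β ∈ (0, β₀] ∃ τ₀ ∀ τ ≥ τ₀ ∃ N₀ ∀ N ≥ N₀ ∀ s, ∫ exp(β Σᵢ 1{…}cubBandᵢ) dλ ≤ e^{ε(N+1)}` —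
typed verbatim as `BandCoherenceLDAlongFamiliesSmallTilt` in the crux workfile `Cruxes/BandCoherenceLDAlongFamilies/Disproof.lean`,
which the boost does not bite (its floor is `O(β²)`); whether C′ still feeds the dock's Grönwall is for the planner
(the crux ideators' R1: pay the band remainder as a SIGNED, Mazur-shifted current inside a quantitative-tilt
`KineticCurrentsLDAlongFamilies`). [folklore] -/
theorem OneFlightGossipEngineBandCoherenceLDAlongFamilies_refuted :
    ¬ Summit.AtomisticToContinuum.HydrodynamicLimit.Theses.OneFlightGossipEngine.BandCoherenceLDAlongFamilies := by
  rintro ⟨η₀, hη₀, H⟩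
  obtain ⟨hσpos, hσ4, -, -⟩ := sigmaOf_spec hη₀
  have hσ2 : sigmaOf η₀ ≤ 1 / 2 := hσ4.trans (by norm_num)
  have hσhalf : sigmaOf η₀ < 2⁻¹ := hσ4.trans_lt (by norm_num)
  -- the Gaussian constant and the parameters
  obtain ⟨M, hM0, hMdef⟩ : ∃ M : ℝ, 0 ≤ M ∧ M = ∫ w, (1 + ‖w‖) ^ 6 ∂stdGaussian V3 := ⟨_, Msix_nonneg, rfl⟩
  obtain ⟨K, hK3, hKM⟩ : ∃ K : ℝ, 3 ≤ K ∧ M = K - 3 := ⟨M + 3, by linarith, by ring⟩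
  have hK0 : 0 < K := by linarith
  have hk0 : (0 : ℝ) < 1 / K := by positivity
  have hk1 : 1 / K ≤ 1 := (div_le_one hK0).2 (by linarith)
  have hkK : 1 / K ≤ K := hk1.trans (by linarith)
  have h1M : 0 < 1 + M := by linarith
  have hη : (0 : ℝ) < 1 / (4 * K * (1 + M)) := by positivity
  have hε : (0 : ℝ) < 1 / (40 * K ^ 2) := by positivity
  have hRm : Measurable (fun p : ℝ × T3 × ℝ =>
      (fun (_ : ℝ) (_ : T3) (s' : ℝ) => if (1 / K) ^ 2 < s' ∧ s' ≤ K ^ 2 then s' - (1 / K) ^ 2 else 0) p.1 p.2.1 p.2.2) :=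
    (measurable_Rrad (1 / K) K).comp measurable_snd.snd
  have key := H 0 1 (fun _ _ => 1) (fun _ _ => 1) (fun _ _ => 0) continuous_const continuous_const continuous_const
    (fun _ _ => one_pos) (fun _ _ => one_pos) (fun _ _ _ => le_rfl) (sigmaOf η₀) hσpos (fun _ _ => guard_sigmaOf hη₀)
    (fun N => regFlowCrux hσpos hσhalf N) (1 / K) K hk0 hkK
    (fun _ _ s' => if (1 / K) ^ 2 < s' ∧ s' ≤ K ^ 2 then s' - (1 / K) ^ 2 else 0) hRm
    (fun _ _ s' hs' => Rrad_eq_zero_of_le hs') (fun _ _ s' => abs_Rrad_le (1 / K) K s')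
    (1 / (4 * K * (1 + M))) hη (1 / (40 * K ^ 2)) hε
  obtain ⟨τ₀, hτ₀, Hτ⟩ := key
  obtain ⟨N₀, HN⟩ := Hτ τ₀ le_rfl
  have hub := HN N₀ le_rfl 0 ⟨le_rfl, le_rfl⟩
  dsimp only at hub
  simp only [sub_zero] at hub
  -- the floor at `D = 1/K`
  have hw : 0 < τ₀ * ((N₀ : ℝ) + 1) ^ (-(1 / 3 : ℝ)) := mul_pos hτ₀ (Real.rpow_pos_of_pos (by positivity) _)
  have hlam : (0 : ℝ) ≤ (8 * 1 * K)⁻¹ := by positivity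
  have hlb := boost_floor hσ2 N₀ (regFlowCrux hσpos hσhalf N₀) (D := 1 / K) (η := 1 / (4 * K * (1 + M)))
    (lam := (8 * 1 * K)⁻¹) hk0.le hkK hK0 hk0.le hk1 hη.le hlam hw
  rw [← hMdef] at hlb
  have h := hlb.trans hub
  rw [ENNReal.ofReal_le_ofReal_iff (Real.exp_pos _).le, Real.exp_le_exp] at h
  -- arithmetic: the floor rate exceeds `ε`
  have hN : (0 : ℝ) < (N₀ : ℝ) + 1 := by positivity
  have hrate : 1 / (40 * K ^ 2) < (8 * 1 * K)⁻¹ * (5 * (1 / K) - (1 / K) ^ 2 * (1 / K) - (1 / K) ^ 3 - M / K ^ 3 -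
      1 / (4 * K * (1 + M)) * (1 + M)) - (1 / K) ^ 2 / 2 := by
    have hKne : K ≠ 0 := hK0.ne'
    have hid : (8 * 1 * K)⁻¹ * (5 * (1 / K) - (1 / K) ^ 2 * (1 / K) - (1 / K) ^ 3 - M / K ^ 3 -
        1 / (4 * K * (1 + M)) * (1 + M)) - (1 / K) ^ 2 / 2 - 1 / (40 * K ^ 2) =
        (11 * K ^ 2 - 20 * K + 20) / (160 * K ^ 4) := by
      rw [hKM]
      have hK2 : (1 : ℝ) + (K - 3) ≠ 0 := by
        intro h0
        linarith
      field_simp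
      ring
    have hnum : 0 < 11 * K ^ 2 - 20 * K + 20 := by nlinarith [sq_nonneg (11 * K - 10)]
    have hpos : 0 < (8 * 1 * K)⁻¹ * (5 * (1 / K) - (1 / K) ^ 2 * (1 / K) - (1 / K) ^ 3 - M / K ^ 3 -
        1 / (4 * K * (1 + M)) * (1 + M)) - (1 / K) ^ 2 / 2 - 1 / (40 * K ^ 2) := by
      rw [hid]
      positivity
    linarith
  have h1 := mul_lt_mul_of_pos_left hrate hN
  linarith

end Summit.AtomisticToContinuum.HydrodynamicLimit.Theorems

end
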